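import Summits.CriticalPhenomena.PercolationContinuityZ3.Theorems.PercNearOneGluingNoHeavyLowerTailWorstPairExchangeCex
import HarnessLib

/-!
# Crux `PercNearOneGluing.AdditiveGluing` (stmt-CriticalPhenomena-4576): the BHK CLASS BOUND for the gluing gain
# EXCEEDS the gluing budget for three relays — a certified weighted counterexample on five vertices

Support file (`--supports stmt-CriticalPhenomena-4576`, depth prover `png-dp-al5`, gen g3); no definitions of mathematical
content (the `def`s are witness data and computable checkers), no named facts, no sorries; the arithmetic is kernel `decide`.

## What is refuted
For a glued set `S = {s₀, s₁, s₂}` with minimiser `s₀` (`τ(s₀) ≤ τ(s₁), τ(s₂)`, `τ(x) = μ(x ↔ b)`), target `b`, observer `o`,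
the conditioned additive-gluing inequality CAG(S) (`= AdditiveGluing` on `{S ↔ b}`, landed `additiveGluing_of_cag`) reads
`Γ_o(S) ≤ G_S`, `Γ_o(S) = μ(o ↮ b, o ↔ S, S ↔ b)`, `G_S = μ(S ↔ b) − τ(s₀)`.  Decomposing the gain event by the CLASS
`T = C_b ∩ S` of the target (`∅ ≠ T ⊊ S`; on the class `T` the observer gains iff it is joined to `S ∖ T`) and applying, class by
class, the two-SET van den Berg–Häggström–Kahn repulsion given `{T ↮ S ∖ T}` (landed `knThm2_bhkTwo` / `stub_bhkSets`:
`{b ↔ every t ∈ T}` and `{o ↔ some s ∈ S ∖ T}` are negatively correlated given the separation) yields the CLASS BOUND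
  `Γ_o(S) ≤ B_o(S) := Σ_{∅ ≠ T ⊊ S} μ(C_b ∩ S = T) · μ(o ↔ S ∖ T | T ↮ S ∖ T)`.
For `|S| = 2` the class bound closes CAG at once (`B_o = M_u q + M_v q' ≤ M_v`, `q + q' ≤ 1`, `M_u ≤ M_v` by the τ-order): this is
the BHK proof of Kozma–Nitzan's Lemma 4.  The natural `|S|`-uniform candidate kernel is therefore the DECOUPLED BUDGET inequality
  (DB)  `B_o(S) ≤ G_S`   (0 violations in ≈ 6·10⁴ random / structured exact instances with `|S| ≤ 5` and on the grid `{.1,.5,.9}^10`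
of `K₅`; seat census lab/s2*.py, kit j060378/j060407/j060411).
**THIS FILE SHOWS THAT (DB) FAILS FOR `|S| = 3`**, at the five-vertex weighted graph
  `s₀ = 0, s₁ = 1, s₂ = 2, o = 3, b = 4`;  `w(4,0) = w(4,1) = 1/20`, `w(4,2) = 1/10`, `w(3,0) = w(3,1) = 99/100`, `w(3,2) = 1/4`
(all other pairs `0`): `τ(s₀) = τ(s₁) = 19024541/160000000 ≤ τ(s₂) = 19475791/160000000`, and
`B_o(S) − G_S = 6325053307/176090080000000 ≈ 3.6·10⁻⁵ > 0` (`G_S = 11015459/160000000`), while CAG itself holds there.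
Mechanism: the observer is an almost-perfect hub between the two weak relays `s₀, s₁`; on the rare classes `{s₀}, {s₁}, {s₀,s₂},
{s₁,s₂}` (which need the hub broken) the decoupled factor `μ(o ↔ S∖T | T ↮ S∖T) ≈ 1/2` overestimates the true conditional gain.
Consequence: the |S|-uniform kernel behind the registered stub `stub_k0set3_g2` is NOT the decoupled class budget; any class-decomposition
proof must keep the coupling between the target's class and the observer's attachment (memo SETKERNEL3-g3.md on the item).
[cite: VandenbergHaggstromKahn2005, Thms. 1.4–1.5 (p. 7)] [cite: KozmaNitzan2024, Lemma 4 (p. 9), Question 7 (p. 36)]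
-/

namespace Summit.CriticalPhenomena.PercolationContinuityZ3.Theorems

open MeasureTheory
open Literature.Probability.LatticeModels Literature.Probability.Percolation
open Summit.CriticalPhenomena.PercolationContinuityZ3.Theorems.AdditiveGluing.Negative.Cert
open Summit.CriticalPhenomena.PercolationContinuityZ3.Theorems.WorstPairExchangeCex (real_eq_wcount)

noncomputable section
open Classical

namespace ClassBoundCex

/-! ### The witness -/

/-- The witness weights on `Fin 5` (`s₀ = 0, s₁ = 1, s₂ = 2`, observer `o = 3`, target `b = 4`):
`w(4,0) = w(4,1) = 1/20, w(4,2) = 1/10, w(3,0) = w(3,1) = 99/100, w(3,2) = 1/4`. -/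
def witCB : List (Fin 5 × Fin 5 × ℚ) :=
  [(4, 0, 1/20), (4, 1, 1/20), (4, 2, 1/10), (3, 0, 99/100), (3, 1, 99/100), (3, 2, 1/4)]

/-- The listed pairs of the witness are distinct. [this file] -/
theorem witCB_nodup : (wPairs witCB).Nodup := by decide

/-- The witness weights lie in `[0, 1]`. [this file] -/
theorem witCB_weights : ∀ e ∈ witCB, 0 ≤ e.2.2 ∧ e.2.2 ≤ 1 := by
  intro e he
  simp only [witCB, List.mem_cons, List.not_mem_nil, or_false] at he
  rcases he with rfl | rfl | rfl | rfl | rfl | rfl <;> norm_num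

/-! ### `Bool` tests on reach tables and exact counts -/

/-- Reach bit: `x ↔ y` according to a reach table. -/
def cb (tb : List ℕ) (x y : ℕ) : Bool := (tb.getD x 0).testBit y

/-- Exact weighted count of a `Bool` test over the `2⁶` sub-configurations of the witness. -/
def cnt (f : List ℕ → Bool) : ℚ := ((wtabs 5 witCB).map fun t => if f t.1 then t.2 else 0).sum

/-- Test of the class event `K_{s₀} = {s₀↔b} ∩ {s₁↮b} ∩ {s₂↮b}`. -/
def fK0 (tb : List ℕ) : Bool := cb tb 0 4 && !cb tb 1 4 && !cb tb 2 4
/-- Test of `K_{s₁}`. -/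
def fK1 (tb : List ℕ) : Bool := cb tb 1 4 && !cb tb 0 4 && !cb tb 2 4
/-- Test of `K_{s₂}`. -/
def fK2 (tb : List ℕ) : Bool := cb tb 2 4 && !cb tb 0 4 && !cb tb 1 4
/-- Test of `K_{s₀s₁}`. -/
def fK01 (tb : List ℕ) : Bool := cb tb 0 4 && cb tb 1 4 && !cb tb 2 4
/-- Test of `K_{s₀s₂}`. -/
def fK02 (tb : List ℕ) : Bool := cb tb 0 4 && cb tb 2 4 && !cb tb 1 4
/-- Test of `K_{s₁s₂}`. -/
def fK12 (tb : List ℕ) : Bool := cb tb 1 4 && cb tb 2 4 && !cb tb 0 4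
/-- Test of the separation `W₀ = {s₀↮s₁} ∩ {s₀↮s₂}` (classes `{s₀}` and `{s₁,s₂}`). -/
def fW0 (tb : List ℕ) : Bool := !cb tb 0 1 && !cb tb 0 2
/-- Test of `W₁ = {s₀↮s₁} ∩ {s₁↮s₂}` (classes `{s₁}` and `{s₀,s₂}`). -/
def fW1 (tb : List ℕ) : Bool := !cb tb 0 1 && !cb tb 1 2
/-- Test of `W₂ = {s₀↮s₂} ∩ {s₁↮s₂}` (classes `{s₂}` and `{s₀,s₁}`). -/
def fW2 (tb : List ℕ) : Bool := !cb tb 0 2 && !cb tb 1 2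
/-- Test of `W₀ ∩ ({o↔s₁} ∪ {o↔s₂})`. -/
def fA0 (tb : List ℕ) : Bool := fW0 tb && (cb tb 3 1 || cb tb 3 2)
/-- Test of `W₁ ∩ ({o↔s₀} ∪ {o↔s₂})`. -/
def fA1 (tb : List ℕ) : Bool := fW1 tb && (cb tb 3 0 || cb tb 3 2)
/-- Test of `W₂ ∩ ({o↔s₀} ∪ {o↔s₁})`. -/
def fA2 (tb : List ℕ) : Bool := fW2 tb && (cb tb 3 0 || cb tb 3 1)
/-- Test of `W₂ ∩ {o↔s₂}` (class `{s₀,s₁}`). -/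
def fA01 (tb : List ℕ) : Bool := fW2 tb && cb tb 3 2
/-- Test of `W₁ ∩ {o↔s₁}` (class `{s₀,s₂}`). -/
def fA02 (tb : List ℕ) : Bool := fW1 tb && cb tb 3 1
/-- Test of `W₀ ∩ {o↔s₀}` (class `{s₁,s₂}`). -/
def fA12 (tb : List ℕ) : Bool := fW0 tb && cb tb 3 0
/-- Test of `{s₀↔b} ∪ {s₁↔b} ∪ {s₂↔b}`. -/
def fU (tb : List ℕ) : Bool := (cb tb 0 4 || cb tb 1 4) || cb tb 2 4

/-- The class bound `B_o(S)` of the witness as an exact rational. -/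
def classBoundQ : ℚ :=
  cnt fK0 * (cnt fA0 / cnt fW0) + cnt fK1 * (cnt fA1 / cnt fW1) + cnt fK2 * (cnt fA2 / cnt fW2) +
    cnt fK01 * (cnt fA01 / cnt fW2) + cnt fK02 * (cnt fA02 / cnt fW1) + cnt fK12 * (cnt fA12 / cnt fW0)

/-! ### The arithmetic (exact rational counts over `2⁶` configurations, kernel `decide`) -/

/-- The facts: `τ(s₀) ≤ τ(s₁)`, `τ(s₀) ≤ τ(s₂)` and the violated budget `G_S < B_o(S)`. [this file] -/
theorem facts : wConn (wtabs 5 witCB) 0 4 ≤ wConn (wtabs 5 witCB) 1 4 ∧ wConn (wtabs 5 witCB) 0 4 ≤ wConn (wtabs 5 witCB) 2 4 ∧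
    cnt fU - wConn (wtabs 5 witCB) 0 4 < classBoundQ := by
  decide +kernel


/-! ### The events of the class bound as exact counts -/

/-- `τ(s) = wConn` at the witness (`s = 0, 1, 2`, `b = 4`). [this file] -/
theorem real_tau (s : Fin 5) :
    (prodBernoulli (wOfList witCB)).real (openConn s (4 : Fin 5)) = (wConn (wtabs 5 witCB) s 4 : ℝ) :=
  real_openConn_eq_wConn witCB_nodup witCB_weights s 4

/-- `μ(K_{s₀})` as an exact count. [this file] -/
theorem real_K0 : (prodBernoulli (wOfList witCB)).real
    (openConn (0 : Fin 5) (4 : Fin 5) ∩ (openConn (1 : Fin 5) (4 : Fin 5))ᶜ ∩ (openConn (2 : Fin 5) (4 : Fin 5))ᶜ) = (cnt fK0 : ℝ) := by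
  refine real_eq_wcount witCB_nodup witCB_weights fK0 _ fun ω => ?_
  simp only [fK0, cb, Bool.and_eq_true, Bool.not_eq_true', Set.mem_inter_iff, Set.mem_compl_iff]
  simp only [← testBit_reachTable_iff_mem_openConn, Bool.not_eq_true]
  rfl

/-- `μ(K_{s₁})` as an exact count. [this file] -/
theorem real_K1 : (prodBernoulli (wOfList witCB)).real
    (openConn (1 : Fin 5) (4 : Fin 5) ∩ (openConn (0 : Fin 5) (4 : Fin 5))ᶜ ∩ (openConn (2 : Fin 5) (4 : Fin 5))ᶜ) = (cnt fK1 : ℝ) := by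
  refine real_eq_wcount witCB_nodup witCB_weights fK1 _ fun ω => ?_
  simp only [fK1, cb, Bool.and_eq_true, Bool.not_eq_true', Set.mem_inter_iff, Set.mem_compl_iff]
  simp only [← testBit_reachTable_iff_mem_openConn, Bool.not_eq_true]
  rfl

/-- `μ(K_{s₂})` as an exact count. [this file] -/
theorem real_K2 : (prodBernoulli (wOfList witCB)).real
    (openConn (2 : Fin 5) (4 : Fin 5) ∩ (openConn (0 : Fin 5) (4 : Fin 5))ᶜ ∩ (openConn (1 : Fin 5) (4 : Fin 5))ᶜ) = (cnt fK2 : ℝ) := by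
  refine real_eq_wcount witCB_nodup witCB_weights fK2 _ fun ω => ?_
  simp only [fK2, cb, Bool.and_eq_true, Bool.not_eq_true', Set.mem_inter_iff, Set.mem_compl_iff]
  simp only [← testBit_reachTable_iff_mem_openConn, Bool.not_eq_true]
  rfl

/-- `μ(K_{s₀s₁})` as an exact count. [this file] -/
theorem real_K01 : (prodBernoulli (wOfList witCB)).real
    (openConn (0 : Fin 5) (4 : Fin 5) ∩ openConn (1 : Fin 5) (4 : Fin 5) ∩ (openConn (2 : Fin 5) (4 : Fin 5))ᶜ) = (cnt fK01 : ℝ) := by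
  refine real_eq_wcount witCB_nodup witCB_weights fK01 _ fun ω => ?_
  simp only [fK01, cb, Bool.and_eq_true, Bool.not_eq_true', Set.mem_inter_iff, Set.mem_compl_iff]
  simp only [← testBit_reachTable_iff_mem_openConn, Bool.not_eq_true]
  rfl

/-- `μ(K_{s₀s₂})` as an exact count. [this file] -/
theorem real_K02 : (prodBernoulli (wOfList witCB)).real
    (openConn (0 : Fin 5) (4 : Fin 5) ∩ openConn (2 : Fin 5) (4 : Fin 5) ∩ (openConn (1 : Fin 5) (4 : Fin 5))ᶜ) = (cnt fK02 : ℝ) := by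
  refine real_eq_wcount witCB_nodup witCB_weights fK02 _ fun ω => ?_
  simp only [fK02, cb, Bool.and_eq_true, Bool.not_eq_true', Set.mem_inter_iff, Set.mem_compl_iff]
  simp only [← testBit_reachTable_iff_mem_openConn, Bool.not_eq_true]
  rfl

/-- `μ(K_{s₁s₂})` as an exact count. [this file] -/
theorem real_K12 : (prodBernoulli (wOfList witCB)).real
    (openConn (1 : Fin 5) (4 : Fin 5) ∩ openConn (2 : Fin 5) (4 : Fin 5) ∩ (openConn (0 : Fin 5) (4 : Fin 5))ᶜ) = (cnt fK12 : ℝ) := by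
  refine real_eq_wcount witCB_nodup witCB_weights fK12 _ fun ω => ?_
  simp only [fK12, cb, Bool.and_eq_true, Bool.not_eq_true', Set.mem_inter_iff, Set.mem_compl_iff]
  simp only [← testBit_reachTable_iff_mem_openConn, Bool.not_eq_true]
  rfl

/-- `μ(W₀)` as an exact count. [this file] -/
theorem real_W0 : (prodBernoulli (wOfList witCB)).real
    ((openConn (0 : Fin 5) (1 : Fin 5))ᶜ ∩ (openConn (0 : Fin 5) (2 : Fin 5))ᶜ) = (cnt fW0 : ℝ) := by
  refine real_eq_wcount witCB_nodup witCB_weights fW0 _ fun ω => ?_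
  simp only [fW0, cb, Bool.and_eq_true, Bool.not_eq_true', Set.mem_inter_iff, Set.mem_compl_iff]
  simp only [← testBit_reachTable_iff_mem_openConn, Bool.not_eq_true]
  rfl

/-- `μ(W₁)` as an exact count. [this file] -/
theorem real_W1 : (prodBernoulli (wOfList witCB)).real
    ((openConn (0 : Fin 5) (1 : Fin 5))ᶜ ∩ (openConn (1 : Fin 5) (2 : Fin 5))ᶜ) = (cnt fW1 : ℝ) := by
  refine real_eq_wcount witCB_nodup witCB_weights fW1 _ fun ω => ?_
  simp only [fW1, cb, Bool.and_eq_true, Bool.not_eq_true', Set.mem_inter_iff, Set.mem_compl_iff]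
  simp only [← testBit_reachTable_iff_mem_openConn, Bool.not_eq_true]
  rfl

/-- `μ(W₂)` as an exact count. [this file] -/
theorem real_W2 : (prodBernoulli (wOfList witCB)).real
    ((openConn (0 : Fin 5) (2 : Fin 5))ᶜ ∩ (openConn (1 : Fin 5) (2 : Fin 5))ᶜ) = (cnt fW2 : ℝ) := by
  refine real_eq_wcount witCB_nodup witCB_weights fW2 _ fun ω => ?_
  simp only [fW2, cb, Bool.and_eq_true, Bool.not_eq_true', Set.mem_inter_iff, Set.mem_compl_iff]
  simp only [← testBit_reachTable_iff_mem_openConn, Bool.not_eq_true]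
  rfl

/-- `μ(W₀ ∩ ({o↔s₁} ∪ {o↔s₂}))` as an exact count. [this file] -/
theorem real_A0 : (prodBernoulli (wOfList witCB)).real
    ((openConn (0 : Fin 5) (1 : Fin 5))ᶜ ∩ (openConn (0 : Fin 5) (2 : Fin 5))ᶜ ∩
      (openConn (3 : Fin 5) (1 : Fin 5) ∪ openConn (3 : Fin 5) (2 : Fin 5))) = (cnt fA0 : ℝ) := by
  refine real_eq_wcount witCB_nodup witCB_weights fA0 _ fun ω => ?_
  simp only [fA0, fW0, cb, Bool.and_eq_true, Bool.not_eq_true', Bool.or_eq_true, Set.mem_inter_iff, Set.mem_compl_iff,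
    Set.mem_union]
  simp only [← testBit_reachTable_iff_mem_openConn, Bool.not_eq_true]
  rfl

/-- `μ(W₁ ∩ ({o↔s₀} ∪ {o↔s₂}))` as an exact count. [this file] -/
theorem real_A1 : (prodBernoulli (wOfList witCB)).real
    ((openConn (0 : Fin 5) (1 : Fin 5))ᶜ ∩ (openConn (1 : Fin 5) (2 : Fin 5))ᶜ ∩
      (openConn (3 : Fin 5) (0 : Fin 5) ∪ openConn (3 : Fin 5) (2 : Fin 5))) = (cnt fA1 : ℝ) := by
  refine real_eq_wcount witCB_nodup witCB_weights fA1 _ fun ω => ?_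
  simp only [fA1, fW1, cb, Bool.and_eq_true, Bool.not_eq_true', Bool.or_eq_true, Set.mem_inter_iff, Set.mem_compl_iff,
    Set.mem_union]
  simp only [← testBit_reachTable_iff_mem_openConn, Bool.not_eq_true]
  rfl

/-- `μ(W₂ ∩ ({o↔s₀} ∪ {o↔s₁}))` as an exact count. [this file] -/
theorem real_A2 : (prodBernoulli (wOfList witCB)).real
    ((openConn (0 : Fin 5) (2 : Fin 5))ᶜ ∩ (openConn (1 : Fin 5) (2 : Fin 5))ᶜ ∩
      (openConn (3 : Fin 5) (0 : Fin 5) ∪ openConn (3 : Fin 5) (1 : Fin 5))) = (cnt fA2 : ℝ) := by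
  refine real_eq_wcount witCB_nodup witCB_weights fA2 _ fun ω => ?_
  simp only [fA2, fW2, cb, Bool.and_eq_true, Bool.not_eq_true', Bool.or_eq_true, Set.mem_inter_iff, Set.mem_compl_iff,
    Set.mem_union]
  simp only [← testBit_reachTable_iff_mem_openConn, Bool.not_eq_true]
  rfl

/-- `μ(W₂ ∩ {o↔s₂})` as an exact count. [this file] -/
theorem real_A01 : (prodBernoulli (wOfList witCB)).real
    ((openConn (0 : Fin 5) (2 : Fin 5))ᶜ ∩ (openConn (1 : Fin 5) (2 : Fin 5))ᶜ ∩ openConn (3 : Fin 5) (2 : Fin 5)) =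
      (cnt fA01 : ℝ) := by
  refine real_eq_wcount witCB_nodup witCB_weights fA01 _ fun ω => ?_
  simp only [fA01, fW2, cb, Bool.and_eq_true, Bool.not_eq_true', Set.mem_inter_iff, Set.mem_compl_iff]
  simp only [← testBit_reachTable_iff_mem_openConn, Bool.not_eq_true]
  rfl

/-- `μ(W₁ ∩ {o↔s₁})` as an exact count. [this file] -/
theorem real_A02 : (prodBernoulli (wOfList witCB)).real
    ((openConn (0 : Fin 5) (1 : Fin 5))ᶜ ∩ (openConn (1 : Fin 5) (2 : Fin 5))ᶜ ∩ openConn (3 : Fin 5) (1 : Fin 5)) =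
      (cnt fA02 : ℝ) := by
  refine real_eq_wcount witCB_nodup witCB_weights fA02 _ fun ω => ?_
  simp only [fA02, fW1, cb, Bool.and_eq_true, Bool.not_eq_true', Set.mem_inter_iff, Set.mem_compl_iff]
  simp only [← testBit_reachTable_iff_mem_openConn, Bool.not_eq_true]
  rfl

/-- `μ(W₀ ∩ {o↔s₀})` as an exact count. [this file] -/
theorem real_A12 : (prodBernoulli (wOfList witCB)).real
    ((openConn (0 : Fin 5) (1 : Fin 5))ᶜ ∩ (openConn (0 : Fin 5) (2 : Fin 5))ᶜ ∩ openConn (3 : Fin 5) (0 : Fin 5)) =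
      (cnt fA12 : ℝ) := by
  refine real_eq_wcount witCB_nodup witCB_weights fA12 _ fun ω => ?_
  simp only [fA12, fW0, cb, Bool.and_eq_true, Bool.not_eq_true', Set.mem_inter_iff, Set.mem_compl_iff]
  simp only [← testBit_reachTable_iff_mem_openConn, Bool.not_eq_true]
  rfl

/-- `μ({s₀↔b} ∪ {s₁↔b} ∪ {s₂↔b})` as an exact count. [this file] -/
theorem real_U : (prodBernoulli (wOfList witCB)).real
    (openConn (0 : Fin 5) (4 : Fin 5) ∪ openConn (1 : Fin 5) (4 : Fin 5) ∪ openConn (2 : Fin 5) (4 : Fin 5)) = (cnt fU : ℝ) := by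
  refine real_eq_wcount witCB_nodup witCB_weights fU _ fun ω => ?_
  simp only [fU, cb, Bool.or_eq_true, Set.mem_union]
  simp only [← testBit_reachTable_iff_mem_openConn]
  rfl

/-! ### The instance and the refutation -/

/-- **The five-vertex instance.**  At the witness (`μ = prodBernoulli (wOfList witCB)`, `s₀ = 0, s₁ = 1, s₂ = 2, o = 3, b = 4`):
`s₀` is a τ-minimiser of `S = {s₀,s₁,s₂}` and the class bound `B_o(S)` STRICTLY EXCEEDS the gluing budget
`μ(S ↔ b) − τ(s₀)`. [this file] -/
theorem classBound_three_cex :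
    (prodBernoulli (wOfList witCB)).real (openConn (0 : Fin 5) (4 : Fin 5)) ≤
        (prodBernoulli (wOfList witCB)).real (openConn (1 : Fin 5) (4 : Fin 5)) ∧
    (prodBernoulli (wOfList witCB)).real (openConn (0 : Fin 5) (4 : Fin 5)) ≤
        (prodBernoulli (wOfList witCB)).real (openConn (2 : Fin 5) (4 : Fin 5)) ∧
    (prodBernoulli (wOfList witCB)).real
          (openConn (0 : Fin 5) (4 : Fin 5) ∪ openConn (1 : Fin 5) (4 : Fin 5) ∪ openConn (2 : Fin 5) (4 : Fin 5)) -
        (prodBernoulli (wOfList witCB)).real (openConn (0 : Fin 5) (4 : Fin 5)) <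
      (prodBernoulli (wOfList witCB)).real
            (openConn (0 : Fin 5) (4 : Fin 5) ∩ (openConn (1 : Fin 5) (4 : Fin 5))ᶜ ∩ (openConn (2 : Fin 5) (4 : Fin 5))ᶜ) *
          ((prodBernoulli (wOfList witCB)).real
              ((openConn (0 : Fin 5) (1 : Fin 5))ᶜ ∩ (openConn (0 : Fin 5) (2 : Fin 5))ᶜ ∩
                (openConn (3 : Fin 5) (1 : Fin 5) ∪ openConn (3 : Fin 5) (2 : Fin 5))) /
            (prodBernoulli (wOfList witCB)).real ((openConn (0 : Fin 5) (1 : Fin 5))ᶜ ∩ (openConn (0 : Fin 5) (2 : Fin 5))ᶜ)) +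
        (prodBernoulli (wOfList witCB)).real
            (openConn (1 : Fin 5) (4 : Fin 5) ∩ (openConn (0 : Fin 5) (4 : Fin 5))ᶜ ∩ (openConn (2 : Fin 5) (4 : Fin 5))ᶜ) *
          ((prodBernoulli (wOfList witCB)).real
              ((openConn (0 : Fin 5) (1 : Fin 5))ᶜ ∩ (openConn (1 : Fin 5) (2 : Fin 5))ᶜ ∩
                (openConn (3 : Fin 5) (0 : Fin 5) ∪ openConn (3 : Fin 5) (2 : Fin 5))) /
            (prodBernoulli (wOfList witCB)).real ((openConn (0 : Fin 5) (1 : Fin 5))ᶜ ∩ (openConn (1 : Fin 5) (2 : Fin 5))ᶜ)) +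
        (prodBernoulli (wOfList witCB)).real
            (openConn (2 : Fin 5) (4 : Fin 5) ∩ (openConn (0 : Fin 5) (4 : Fin 5))ᶜ ∩ (openConn (1 : Fin 5) (4 : Fin 5))ᶜ) *
          ((prodBernoulli (wOfList witCB)).real
              ((openConn (0 : Fin 5) (2 : Fin 5))ᶜ ∩ (openConn (1 : Fin 5) (2 : Fin 5))ᶜ ∩
                (openConn (3 : Fin 5) (0 : Fin 5) ∪ openConn (3 : Fin 5) (1 : Fin 5))) /
            (prodBernoulli (wOfList witCB)).real ((openConn (0 : Fin 5) (2 : Fin 5))ᶜ ∩ (openConn (1 : Fin 5) (2 : Fin 5))ᶜ)) +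
        (prodBernoulli (wOfList witCB)).real
            (openConn (0 : Fin 5) (4 : Fin 5) ∩ openConn (1 : Fin 5) (4 : Fin 5) ∩ (openConn (2 : Fin 5) (4 : Fin 5))ᶜ) *
          ((prodBernoulli (wOfList witCB)).real
              ((openConn (0 : Fin 5) (2 : Fin 5))ᶜ ∩ (openConn (1 : Fin 5) (2 : Fin 5))ᶜ ∩ openConn (3 : Fin 5) (2 : Fin 5)) /
            (prodBernoulli (wOfList witCB)).real ((openConn (0 : Fin 5) (2 : Fin 5))ᶜ ∩ (openConn (1 : Fin 5) (2 : Fin 5))ᶜ)) +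
        (prodBernoulli (wOfList witCB)).real
            (openConn (0 : Fin 5) (4 : Fin 5) ∩ openConn (2 : Fin 5) (4 : Fin 5) ∩ (openConn (1 : Fin 5) (4 : Fin 5))ᶜ) *
          ((prodBernoulli (wOfList witCB)).real
              ((openConn (0 : Fin 5) (1 : Fin 5))ᶜ ∩ (openConn (1 : Fin 5) (2 : Fin 5))ᶜ ∩ openConn (3 : Fin 5) (1 : Fin 5)) /
            (prodBernoulli (wOfList witCB)).real ((openConn (0 : Fin 5) (1 : Fin 5))ᶜ ∩ (openConn (1 : Fin 5) (2 : Fin 5))ᶜ)) +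
        (prodBernoulli (wOfList witCB)).real
            (openConn (1 : Fin 5) (4 : Fin 5) ∩ openConn (2 : Fin 5) (4 : Fin 5) ∩ (openConn (0 : Fin 5) (4 : Fin 5))ᶜ) *
          ((prodBernoulli (wOfList witCB)).real
              ((openConn (0 : Fin 5) (1 : Fin 5))ᶜ ∩ (openConn (0 : Fin 5) (2 : Fin 5))ᶜ ∩ openConn (3 : Fin 5) (0 : Fin 5)) /
            (prodBernoulli (wOfList witCB)).real ((openConn (0 : Fin 5) (1 : Fin 5))ᶜ ∩ (openConn (0 : Fin 5) (2 : Fin 5))ᶜ)) := by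
  refine ⟨?_, ?_, ?_⟩
  · rw [real_tau, real_tau]; exact_mod_cast facts.1
  · rw [real_tau, real_tau]; exact_mod_cast facts.2.1
  · rw [real_U, real_tau, real_K0, real_K1, real_K2, real_K01, real_K02, real_K12, real_W0, real_W1, real_W2, real_A0, real_A1,
      real_A2, real_A01, real_A02, real_A12]
    have h := facts.2.2
    simp only [classBoundQ] at h
    exact_mod_cast h

end ClassBoundCex

open ClassBoundCex

/-- **The decoupled class budget (DB) is FALSE for three glued relays.**  (DB) — "for every finite weighted graph, every
three distinct relays `s₀, s₁, s₂` with `τ(s₀) ≤ τ(s₁), τ(s₂)` (`τ(x) = μ(x↔b)`), target `b` and observer `o` off the relays, the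
class bound `B_o(S) = Σ_{∅≠T⊊S} μ(C_b ∩ S = T)·μ(o ↔ S∖T | T ↮ S∖T)` is at most the gluing budget `μ(S↔b) − τ(s₀)`" —
written with the six classes of `S = {s₀,s₁,s₂}` spelled out (class `T` = `b` joined to every vertex of `T` and to no vertex of
`S∖T`; separation `{T ↮ S∖T}`; conditional probability as a real quotient).  Since `Γ_o(S) ≤ B_o(S)` (BHK two-set repulsion,
`knThm2_bhkTwo`), (DB) would have given CAG(S), i.e. `AdditiveGluing` at `|A| = 3`, by the class decomposition; the witness
`classBound_three_cex` kills this route (not CAG, which holds at the witness). [this file] -/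
theorem not_classBoundBudget_three :
    ¬ (∀ (n : ℕ) (w : Sym2 (Fin n) → unitInterval) (s₀ s₁ s₂ o b : Fin n),
        s₀ ≠ s₁ → s₀ ≠ s₂ → s₁ ≠ s₂ → o ≠ s₀ → o ≠ s₁ → o ≠ s₂ → o ≠ b → b ≠ s₀ → b ≠ s₁ → b ≠ s₂ →
        (prodBernoulli w).real (openConn s₀ b) ≤ (prodBernoulli w).real (openConn s₁ b) →
        (prodBernoulli w).real (openConn s₀ b) ≤ (prodBernoulli w).real (openConn s₂ b) →
        (prodBernoulli w).real (openConn s₀ b ∩ (openConn s₁ b)ᶜ ∩ (openConn s₂ b)ᶜ) *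
            ((prodBernoulli w).real ((openConn s₀ s₁)ᶜ ∩ (openConn s₀ s₂)ᶜ ∩ (openConn o s₁ ∪ openConn o s₂)) /
              (prodBernoulli w).real ((openConn s₀ s₁)ᶜ ∩ (openConn s₀ s₂)ᶜ)) +
          (prodBernoulli w).real (openConn s₁ b ∩ (openConn s₀ b)ᶜ ∩ (openConn s₂ b)ᶜ) *
            ((prodBernoulli w).real ((openConn s₀ s₁)ᶜ ∩ (openConn s₁ s₂)ᶜ ∩ (openConn o s₀ ∪ openConn o s₂)) /
              (prodBernoulli w).real ((openConn s₀ s₁)ᶜ ∩ (openConn s₁ s₂)ᶜ)) +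
          (prodBernoulli w).real (openConn s₂ b ∩ (openConn s₀ b)ᶜ ∩ (openConn s₁ b)ᶜ) *
            ((prodBernoulli w).real ((openConn s₀ s₂)ᶜ ∩ (openConn s₁ s₂)ᶜ ∩ (openConn o s₀ ∪ openConn o s₁)) /
              (prodBernoulli w).real ((openConn s₀ s₂)ᶜ ∩ (openConn s₁ s₂)ᶜ)) +
          (prodBernoulli w).real (openConn s₀ b ∩ openConn s₁ b ∩ (openConn s₂ b)ᶜ) *
            ((prodBernoulli w).real ((openConn s₀ s₂)ᶜ ∩ (openConn s₁ s₂)ᶜ ∩ openConn o s₂) /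
              (prodBernoulli w).real ((openConn s₀ s₂)ᶜ ∩ (openConn s₁ s₂)ᶜ)) +
          (prodBernoulli w).real (openConn s₀ b ∩ openConn s₂ b ∩ (openConn s₁ b)ᶜ) *
            ((prodBernoulli w).real ((openConn s₀ s₁)ᶜ ∩ (openConn s₁ s₂)ᶜ ∩ openConn o s₁) /
              (prodBernoulli w).real ((openConn s₀ s₁)ᶜ ∩ (openConn s₁ s₂)ᶜ)) +
          (prodBernoulli w).real (openConn s₁ b ∩ openConn s₂ b ∩ (openConn s₀ b)ᶜ) *
            ((prodBernoulli w).real ((openConn s₀ s₁)ᶜ ∩ (openConn s₀ s₂)ᶜ ∩ openConn o s₀) /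
              (prodBernoulli w).real ((openConn s₀ s₁)ᶜ ∩ (openConn s₀ s₂)ᶜ)) ≤
        (prodBernoulli w).real (openConn s₀ b ∪ openConn s₁ b ∪ openConn s₂ b) - (prodBernoulli w).real (openConn s₀ b)) := by
  intro h
  obtain ⟨h01, h02, hgt⟩ := classBound_three_cex
  have hle := h 5 (wOfList witCB) 0 1 2 3 4 (by decide) (by decide) (by decide) (by decide) (by decide) (by decide) (by decide)
    (by decide) (by decide) (by decide) h01 h02
  exact absurd hle (not_le.2 hgt)

end

end Summit.CriticalPhenomena.PercolationContinuityZ3.Theorems
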